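import Literature.Geometry.Kaehler.ComplexTorusPeriodicAnalyticSet
import Literature.Geometry.Kaehler.HolomorphicChainWirtingerPeriods
import HarnessLib

/-!
# The class of a closed analytic subvariety of a complex torus

Layer `Literature/Geometry/Kaehler`; lane `lit-hodgefound`, Layer A4, row A4-18 (b) stage (ii)
(`run/shared/lean/pub/lit-hodgefound/SKELETON.md` §P Q58; `lit-hodgefound-p07/Q58-STAGING.md`). For the
complex torus `X = E/Λ`, `Λ = Φ(ℤ^ι)` (`ComplexTorus Φ`, a compact complex manifold modelled on `E`,
`ComplexTorus.lean`; `E` a finite-dimensional complex inner product space — the flat Kähler metric)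
and an analytic subset `Z ⊆ X` of pure dimension `d` (tree: `HasPureDim 𝓘(ℂ, E) Z d`; analytic subsets
in the tree's sense are closed), we construct the CLASS of `Z` in
`H^{2p}(X, ℂ) = Alt^{2p}_ℝ(E; ℂ)` (`2d + 2p = rk Λ`), following C. Voisin, *Hodge Theory and Complex
Algebraic Geometry I* (2002), §11.1.2 (the class of `Z` is the Poincaré dual of the current of
integration `α ↦ ∫_Z α_{|Z}`, Cor. 11.15 / Thm. 11.21) and §11.1.3 Prop. 11.20 ("The image in
`H^{2r}(X, ℂ)` of the class `[Z]` lies in `H^{r,r}(X)`"), and H. Lange, *Abelian Varieties over the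
Complex Numbers* (2023), §1.1.4 (invariant forms = cohomology), §6.2.1 Lemma 6.2.7, §6.2.4 (Poincaré
duality):

* `ComplexTorus.liftSet Φ Z ⊆ E` — the lift `π⁻¹(Z)` of `Z` to the universal cover (as a subset of the
  manifold `⊤ : Opens E`); it is `Λ`-periodic (`translateTop_preimage_liftSet`), analytic
  (`isAnalyticSet_liftSet`), with the same regular points of each codimension as `Z`
  (`isRegularPointOfCodim_liftSet_iff`: `π` is a local biholomorphism — tree `mfderiv_cover = id` and the
  charts `chart_cover`), hence of pure dimension `d` (**`hasPureDim_liftSet`**);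
* `ComplexTorus.analyticCyclePeriod Φ hZ : Alt^{2d}_ℝ(E; ℂ) →ₗ[ℂ] ℂ` — **the current of integration
  `ω ↦ ∫_Z ω` of `Z` on the invariant forms**: the period functional `torusPeriod` of the holomorphic
  chain `[π⁻¹ Z]` (`HolomorphicChain.ofSet`, Chirka (1989), §14.1) over a fundamental domain of `Λ`
  (`ComplexTorusChainPeriods.lean`); by `ComplexTorusPeriodicAnalyticSet.lean` it does not depend on the
  fundamental domain (`analyticCyclePeriod_eq_constPeriod`); it kills the off-type forms
  (`analyticCyclePeriod_eq_zero_of_isOfTypeAt`, Voisin (11.6)) and `∫_Z ω^d/d! = vol_{2d}(Z)`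
  (`analyticCyclePeriod_kaehlerPow`, Wirtinger);
* **`ComplexTorus.analyticCycleClass Φ e h hZ := (analyticCyclePeriod Φ hZ)^♭ ∈ H^{2p}(X, ℂ)`** — the class
  of `Z` (`⟨γ, [Z]⟩_e = ∫_Z γ`, `poincarePairing_analyticCycleClass`); **`isOfTypeAt_analyticCycleClass`**:
  it is of type `(p, p)` (Voisin, Prop. 11.20) — UNCONDITIONALLY; `analyticCycleClass_mem_integralHodgeClasses`:
  it lies in `H^{2p}(X, ℤ) ∩ H^{p,p}` as soon as the periods `∫_Z η`, `η ∈ H^{2d}(X, ℤ)`, are integers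
  (the remaining input `[Z] ∈ H_{2d}(X, ℤ)`, node N5); `poincarePairing_kaehlerPow_analyticCycleClass`
  (`⟨ω^d/d!, [Z]⟩ = vol(Z)`) and `analyticCycleClass_ne_zero_of_measure_pos` (a subvariety of positive
  volume has non-zero class).

Definitions with bodies and theorems; no named fact.

## References

* [VoisinHodgeI2002] C. Voisin, *Hodge Theory and Complex Algebraic Geometry I*, CUP (2002), §11.1.2
  Cor. 11.15, Thm. 11.21, §11.1.3 Prop. 11.20.
* [Lange2023AbelianVarietiesComplex] H. Lange, *Abelian Varieties over the Complex Numbers*, Springer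
  (2023), §1.1.4, §6.2.1 Lemma 6.2.7, §6.2.4.
* [Chirka1989] E. M. Chirka, *Complex Analytic Sets*, Kluwer (1989), §2.3, §14.1.
-/

noncomputable section

open scoped Manifold ENNReal NNReal ContDiff
open MeasureTheory TopologicalSpace Set Function Complex Module
open Literature.Analysis.Complex (IsOfTypeAt)
open Literature.Geometry.GeometricMeasureTheory

namespace Literature.Geometry.Kaehler

-- Nested operator-norm instances on `Covector V m` / `Multivector V m`, as in `Currents.lean`.
set_option maxSynthPendingDepth 2

universe u

/-! ### Regular points: a local pull-back lemma and translation invariance in the model space -/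

section RegularPoints

variable {E₁ : Type*} [NormedAddCommGroup E₁] [NormedSpace ℂ E₁] {H : Type*} [TopologicalSpace H]
  {I : ModelWithCorners ℂ E₁ H} {M : Type*} [TopologicalSpace M] [ChartedSpace H M]
  {E' : Type*} [NormedAddCommGroup E'] [NormedSpace ℂ E'] {H' : Type*} [TopologicalSpace H']
  {I' : ModelWithCorners ℂ E' H'} {M' : Type*} [TopologicalSpace M'] [ChartedSpace H' M']

/-- **Regular points pull back along a map which is holomorphic with surjective differential NEAR the
point** (local form of `IsRegularPointOfCodim.preimage`, for partially defined charts): if `g` is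
`MDifferentiable` on an open `W ∋ x`, `dg(x)` is onto and `g x` is a regular point of codimension `q` of
`Z`, then `x` is a regular point of codimension `q` of `g ⁻¹' Z`. [cite: Chirka1989, §2.3] -/
theorem IsRegularPointOfCodim.preimage_of_mdifferentiableAt {Z : Set M'} {q : ℕ} {g : M → M'} {x : M}
    {W : Set M} (h : IsRegularPointOfCodim I' Z q (g x)) (hW : IsOpen W) (hxW : x ∈ W)
    (hg : ∀ y ∈ W, MDifferentiableAt I I' g y) (hsurj : Function.Surjective (mfderiv I I' g x)) :
    IsRegularPointOfCodim I (g ⁻¹' Z) q x := by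
  obtain ⟨U, hU, hxU, f, hf, hZU, hfs⟩ := h
  have hgc : ContinuousOn g W := fun y hy ↦ (hg y hy).continuousAt.continuousWithinAt
  refine ⟨W ∩ g ⁻¹' U, hgc.isOpen_inter_preimage hW hU, ⟨hxW, hxU⟩, f ∘ g, ?_, ?_, ?_⟩
  · intro y hy
    exact ((hf (g y) hy.2).mdifferentiableAt (hU.mem_nhds hy.2)).comp_mdifferentiableWithinAt y
      (hg y hy.1).mdifferentiableWithinAt
  · ext y
    constructor
    · rintro ⟨hyZ, hyW, hyU⟩
      exact ⟨⟨hyW, hyU⟩, (hZU.subset ⟨hyZ, hyU⟩).2⟩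
    · rintro ⟨⟨hyW, hyU⟩, hfy⟩
      exact ⟨(hZU.symm.subset ⟨hyU, hfy⟩).1, hyW, hyU⟩
  · have hcomp : mfderiv I 𝓘(ℂ, Fin q → ℂ) (f ∘ g) x =
        (mfderiv I' 𝓘(ℂ, Fin q → ℂ) f (g x)).comp (mfderiv I I' g x) :=
      mfderiv_comp x (hf.mdifferentiableAt (hU.mem_nhds hxU)) (hg x hxW)
    intro w
    obtain ⟨v, hv⟩ := hfs w
    obtain ⟨u, hu⟩ := hsurj v
    refine ⟨u, (DFunLike.congr_fun hcomp u).trans ?_⟩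
    change mfderiv I' 𝓘(ℂ, Fin q → ℂ) f (g x) (mfderiv I I' g x u) = w
    rw [hu, hv]

end RegularPoints

section ModelSpace

variable {E : Type u} [NormedAddCommGroup E]

/-- The identification `(⊤ : Opens E) ≃ₜ E` (the open subset `⊤` of the manifold `E`). [cite: Chirka1989, §2.3] -/
def topHomeomorph : (⊤ : Opens E) ≃ₜ E where
  toFun := Subtype.val
  invFun x := ⟨x, trivial⟩
  left_inv _ := rfl
  right_inv _ := rfl
  continuous_toFun := continuous_subtype_val
  continuous_invFun := continuous_id.subtype_mk _

/-- `topHomeomorph x = x`. [cite: Chirka1989, §2.3] -/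
@[simp] theorem topHomeomorph_apply (x : (⊤ : Opens E)) : topHomeomorph x = (x : E) := rfl

/-- `topHomeomorph.symm x = ⟨x, _⟩`. [cite: Chirka1989, §2.3] -/
@[simp] theorem coe_topHomeomorph_symm_apply (x : E) :
    ((topHomeomorph.symm x : (⊤ : Opens E)) : E) = x :=
  rfl

variable [NormedSpace ℂ E]

/-- Translations of the model space are `MDifferentiable`. [folklore] -/
private theorem mdifferentiable_const_add (b : E) :
    MDifferentiable 𝓘(ℂ, E) 𝓘(ℂ, E) fun x : E ↦ b + x :=
  ((contDiff_const.add contDiff_id).contMDiff (n := 1)).mdifferentiable one_ne_zero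

/-- **Regular points of a translation-invariant subset of `E` are translation-invariant.**
[cite: Chirka1989, §2.3] -/
theorem IsRegularPointOfCodim.const_add {S : Set E} {b : E} (hS : (fun x ↦ b + x) ⁻¹' S = S)
    {q : ℕ} {x : E} (h : IsRegularPointOfCodim 𝓘(ℂ, E) S q x) :
    IsRegularPointOfCodim 𝓘(ℂ, E) S q (b + x) := by
  have h' : IsRegularPointOfCodim 𝓘(ℂ, E) ((Homeomorph.addLeft b) ⁻¹' S) q x := by
    rw [show ((Homeomorph.addLeft b) ⁻¹' S : Set E) = S from hS]; exact h
  have hsymm : MDifferentiable 𝓘(ℂ, E) 𝓘(ℂ, E) (Homeomorph.addLeft b).symm := by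
    have : ((Homeomorph.addLeft b).symm : E → E) = fun x ↦ -b + x := by
      funext x; simp [Homeomorph.addLeft, neg_add_eq_sub]
    rw [this]; exact mdifferentiable_const_add (-b)
  exact h'.of_preimage_homeomorph (Homeomorph.addLeft b) (mdifferentiable_const_add b) hsymm

/-- `topHomeomorph` is holomorphic (the inclusion of an open subset is a chart). [cite: Chirka1989, §2.3] -/
theorem mdifferentiable_topHomeomorph :
    MDifferentiable 𝓘(ℂ, E) 𝓘(ℂ, E) (topHomeomorph : (⊤ : Opens E) → E) :=
  (contMDiff_subtype_val (n := 1)).mdifferentiable one_ne_zero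

/-- … with holomorphic inverse. [cite: Chirka1989, §2.3] -/
theorem mdifferentiable_topHomeomorph_symm :
    MDifferentiable 𝓘(ℂ, E) 𝓘(ℂ, E) (topHomeomorph.symm : E → (⊤ : Opens E)) := by
  have h : ContMDiff 𝓘(ℂ, E) 𝓘(ℂ, E) ∞ (topHomeomorph.symm : E → (⊤ : Opens E)) := by
    rw [← ContMDiff.subtypeVal_comp_iff]
    exact contMDiff_id
  exact h.mdifferentiable (by simp)

end ModelSpace

/-! ### The lift of an analytic subset of the torus to the universal cover -/

namespace ComplexTorus

variable {ι : Type*} {E : Type u} [NormedAddCommGroup E] [NormedSpace ℂ E] (Φ : (ι → ℝ) ≃L[ℝ] E)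

/-- **The lift `π⁻¹(Z)` of a subset `Z` of the torus `X = E/Λ` to the universal cover**, as a subset of
the complex manifold `⊤ : Opens E` (on which holomorphic chains of `E` live).
[cite: Lange2023AbelianVarietiesComplex, §1.1.4] -/
def liftSet (Z : Set (ComplexTorus Φ)) : Set (⊤ : Opens E) := {x | cover Φ x ∈ Z}

/-- Membership in the lift. [cite: Lange2023AbelianVarietiesComplex, §1.1.4] -/
@[simp] theorem mem_liftSet_iff {Z : Set (ComplexTorus Φ)} {x : (⊤ : Opens E)} :
    x ∈ liftSet Φ Z ↔ cover Φ x ∈ Z := Iff.rfl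

/-- The lift is `topHomeomorph ⁻¹' (π ⁻¹' Z)`. [cite: Lange2023AbelianVarietiesComplex, §1.1.4] -/
theorem liftSet_eq_preimage (Z : Set (ComplexTorus Φ)) :
    liftSet Φ Z = topHomeomorph ⁻¹' (cover Φ ⁻¹' Z) := rfl

/-- **The lift is `Λ`-periodic.** [cite: Lange2023AbelianVarietiesComplex, §1.1.4] -/
theorem translateTop_preimage_liftSet (Z : Set (ComplexTorus Φ)) (m : ι → ℤ) :
    translateTop (latticeVec Φ m) ⁻¹' liftSet Φ Z = liftSet Φ Z := by
  ext x
  simp only [mem_preimage, mem_liftSet_iff, coe_translateTop]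
  rw [add_comm, cover_add_latticeVec]

/-- `π ⁻¹' Z ⊆ E` is invariant under translation by lattice vectors. [cite: Lange2023AbelianVarietiesComplex, §1.1.4] -/
theorem const_add_preimage_cover_preimage (Z : Set (ComplexTorus Φ)) (m : ι → ℤ) :
    (fun x : E ↦ latticeVec Φ m + x) ⁻¹' (cover Φ ⁻¹' Z) = cover Φ ⁻¹' Z := by
  ext x
  simp only [mem_preimage]
  rw [add_comm, cover_add_latticeVec]

variable [Fintype ι]

/-- The lift of a nonempty set is nonempty (`π` is onto). [cite: Lange2023AbelianVarietiesComplex, §1.1.4] -/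
theorem liftSet_nonempty {Z : Set (ComplexTorus Φ)} (hZ : Z.Nonempty) : (liftSet Φ Z).Nonempty := by
  obtain ⟨y, hy⟩ := hZ
  obtain ⟨x, rfl⟩ := cover_surjective Φ y
  exact ⟨⟨x, trivial⟩, hy⟩

/-- **The lift of an analytic set is analytic** (`π` is holomorphic). [cite: Chirka1989, §2.3] -/
theorem isAnalyticSet_liftSet {Z : Set (ComplexTorus Φ)} (hZ : IsAnalyticSet 𝓘(ℂ, E) Z) :
    IsAnalyticSet 𝓘(ℂ, E) (liftSet Φ Z) := by
  rw [liftSet_eq_preimage, ← preimage_comp]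
  exact hZ.preimage ((mdifferentiable_cover Φ).comp mdifferentiable_topHomeomorph)

/-- **Regular points of `π⁻¹(Z) ⊆ E` are exactly the lifts of regular points of `Z`, with the same
codimension** (`π` is a local biholomorphism: `dπ = id`, and the charts of `X` are local sections of
`π`). [cite: Chirka1989, §2.3] -/
theorem isRegularPointOfCodim_cover_preimage_iff {Z : Set (ComplexTorus Φ)} {q : ℕ} (x : E) :
    IsRegularPointOfCodim 𝓘(ℂ, E) (cover Φ ⁻¹' Z) q x ↔ IsRegularPointOfCodim 𝓘(ℂ, E) Z q (cover Φ x) := by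
  constructor
  · intro h
    -- the chart at `π x` is a local section of `π` through a lattice translate of `x`
    set y := cover Φ x with hy
    have hσy : chartAt E y y = x - latticeVec Φ (boxIndex Φ (corner Φ y) x) := by
      rw [chartAt_eq, hy, chart_cover]
    -- regularity at the translate
    have hx' : IsRegularPointOfCodim 𝓘(ℂ, E) (cover Φ ⁻¹' Z) q (chartAt E y y) := by
      rw [hσy, sub_eq_add_neg, add_comm]
      refine h.const_add ?_
      have hneg : -latticeVec Φ (boxIndex Φ (corner Φ y) x) = latticeVec Φ (-boxIndex Φ (corner Φ y) x) := by
        simp only [latticeVec, Pi.neg_apply, Int.cast_neg, ← map_neg]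
        rfl
      rw [hneg]
      exact const_add_preimage_cover_preimage Φ Z _
    -- pull back along the chart (holomorphic on its source, with invertible differential)
    have hσ := mdifferentiable_chart (I := 𝓘(ℂ, E)) y
    have hpre : IsRegularPointOfCodim 𝓘(ℂ, E) ((chartAt E y) ⁻¹' (cover Φ ⁻¹' Z)) q y :=
      hx'.preimage_of_mdifferentiableAt (chartAt E y).open_source (mem_chart_source E y)
        (fun y' hy' ↦ hσ.mdifferentiableAt hy') (hσ.mfderiv_surjective (mem_chart_source E y))
    -- on the chart source, `Z` IS that pull-back: `π ∘ chart = id`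
    refine hpre.congr_set (chartAt E y).open_source (mem_chart_source E y) ?_
    ext y'
    simp only [mem_inter_iff, mem_preimage]
    constructor
    · rintro ⟨hy'Z, hy's⟩
      refine ⟨?_, hy's⟩
      have h1 : cover Φ (chartAt E y y') = y' := (chartAt E y).left_inv hy's
      rw [h1] at hy'Z
      exact hy'Z
    · rintro ⟨hy'Z, hy's⟩
      refine ⟨?_, hy's⟩
      have h1 : cover Φ (chartAt E y y') = y' := (chartAt E y).left_inv hy's
      rw [h1]
      exact hy'Z
  · intro h
    exact h.preimage (mdifferentiable_cover Φ) (by rw [mfderiv_cover]; exact fun v ↦ ⟨v, rfl⟩)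

/-- The same for the lift as a subset of the manifold `⊤ : Opens E`. [cite: Chirka1989, §2.3] -/
theorem isRegularPointOfCodim_liftSet_iff {Z : Set (ComplexTorus Φ)} {q : ℕ} (x : (⊤ : Opens E)) :
    IsRegularPointOfCodim 𝓘(ℂ, E) (liftSet Φ Z) q x ↔ IsRegularPointOfCodim 𝓘(ℂ, E) Z q (cover Φ x) := by
  rw [liftSet_eq_preimage, ← isRegularPointOfCodim_cover_preimage_iff Φ (x : E)]
  constructor
  · intro h
    exact h.of_preimage_homeomorph topHomeomorph mdifferentiable_topHomeomorph
      mdifferentiable_topHomeomorph_symm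
  · intro h
    exact h.preimage mdifferentiable_topHomeomorph (surjective_mfderiv_of_homeomorph topHomeomorph
      mdifferentiable_topHomeomorph mdifferentiable_topHomeomorph_symm x)

/-- Regular loci correspond under the lift. [cite: Chirka1989, §2.3] -/
theorem mem_regularLocus_liftSet_iff {Z : Set (ComplexTorus Φ)} (x : (⊤ : Opens E)) :
    x ∈ regularLocus 𝓘(ℂ, E) (liftSet Φ Z) ↔ cover Φ x ∈ regularLocus 𝓘(ℂ, E) Z := by
  simp only [regularLocus, mem_setOf_eq, mem_liftSet_iff, isRegularPointOfCodim_liftSet_iff]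

/-- **The lift of an analytic subset of pure dimension `d` has pure dimension `d`.**
[cite: Chirka1989, §2.3] -/
theorem hasPureDim_liftSet {Z : Set (ComplexTorus Φ)} {d : ℕ} (hZ : HasPureDim 𝓘(ℂ, E) Z d) :
    HasPureDim 𝓘(ℂ, E) (liftSet Φ Z) d := by
  obtain ⟨c, hdc, hZa, hZne, hZreg⟩ := hZ
  refine ⟨c, hdc, isAnalyticSet_liftSet Φ hZa, liftSet_nonempty Φ hZne, fun x hx ↦ ?_⟩
  rw [isRegularPointOfCodim_liftSet_iff]
  exact hZreg _ ((mem_regularLocus_liftSet_iff Φ x).1 hx)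

end ComplexTorus

/-! ### The class of an analytic subvariety -/

namespace ComplexTorus

variable {ι : Type*} [Fintype ι] {E : Type u} [NormedAddCommGroup E] [InnerProductSpace ℂ E]
  [FiniteDimensional ℂ E] [MeasurableSpace E] [BorelSpace E] (Φ : (ι → ℝ) ≃L[ℝ] E) {d : ℕ}

/-- **The holomorphic chain `[π⁻¹ Z]` on `E`** of an analytic subset `Z ⊆ X` of pure dimension `d` (all
multiplicities `1`; Chirka (1989), §14.1). [cite: Chirka1989, §14.1 Cor., p. 174] -/
def analyticChain {Z : Set (ComplexTorus Φ)} (hZ : HasPureDim 𝓘(ℂ, E) Z d) :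
    HolomorphicChain 𝓘(ℂ, E) (⊤ : Opens E) d :=
  HolomorphicChain.ofSet (liftSet Φ Z) (hasPureDim_liftSet Φ hZ)

/-- **The current of integration `ω ↦ ∫_Z ω` of an analytic subset `Z ⊆ X` of pure dimension `d` on the
invariant `2d`-forms** `Alt^{2d}_ℝ(E; ℂ) = H^{2d}(X, ℂ)`: the period functional of the chain `[π⁻¹ Z]`
over a fundamental domain of `Λ` (Voisin (2002), §11.1.2, Thm. 11.21: `α ↦ ∫_{Z_smooth} α`; Chirka
(1989), §14.1: `⟨[A], φ⟩ = ∫_{reg A} φ`). [cite: VoisinHodgeI2002, §11.1.2 Cor. 11.15] -/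
def analyticCyclePeriod {Z : Set (ComplexTorus Φ)} (hZ : HasPureDim 𝓘(ℂ, E) Z d) :
    (E [⋀^Fin (2 * d)]→L[ℝ] ℂ) →ₗ[ℂ] ℂ :=
  (analyticChain Φ hZ).torusPeriod Φ

/-- **The current of integration of `Z` does not depend on the fundamental domain**: for every
admissible fundamental domain `D` of `Λ` (for `𝓗^{2d} ⌞ reg π⁻¹Z`),
`analyticCyclePeriod Φ hZ = constPeriod [π⁻¹ Z] D`. [cite: VoisinHodgeI2002, §11.1.2 Cor. 11.15] -/
theorem analyticCyclePeriod_eq_constPeriod {Z : Set (ComplexTorus Φ)} (hZ : HasPureDim 𝓘(ℂ, E) Z d)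
    {D : Set E}
    (hD : IsAddFundamentalDomain (periodLattice Φ) D
      ((μHE[2 * d] : Measure E).restrict (analyticChain Φ hZ).carrier))
    (hDi : IntegrableOn (fun x ↦ ((analyticChain Φ hZ).density x : ℝ) •
        frameVector ((analyticChain Φ hZ).orientationFrame x))
      D ((μHE[2 * d] : Measure E).restrict (analyticChain Φ hZ).carrier)) :
    analyticCyclePeriod Φ hZ = (analyticChain Φ hZ).constPeriod D :=
  HolomorphicChain.torusPeriod_ofSet_eq_constPeriod Φ (hasPureDim_liftSet Φ hZ)
    (translateTop_preimage_liftSet Φ Z) hD hDi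

/-- … in particular every period box computes it. [cite: VoisinHodgeI2002, §11.1.2 Cor. 11.15] -/
theorem analyticCyclePeriod_eq_constPeriod_periodBox {Z : Set (ComplexTorus Φ)}
    (hZ : HasPureDim 𝓘(ℂ, E) Z d) (a : ι → ℝ) :
    analyticCyclePeriod Φ hZ = (analyticChain Φ hZ).constPeriod (periodBox Φ a) :=
  HolomorphicChain.torusPeriod_ofSet_eq_constPeriod_periodBox Φ (hasPureDim_liftSet Φ hZ)
    (translateTop_preimage_liftSet Φ Z) a

/-- **`∫_Z ω = 0` for `ω` of type `(r, s)`, `r ≠ s`** (Voisin (11.6): the current of an analytic cycle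
has bidimension `(d, d)`). [cite: VoisinHodgeI2002, §11.1.3 Thm. 11.21 and (11.6)] -/
theorem analyticCyclePeriod_eq_zero_of_isOfTypeAt {Z : Set (ComplexTorus Φ)}
    (hZ : HasPureDim 𝓘(ℂ, E) Z d) {η : E [⋀^Fin (2 * d)]→L[ℝ] ℂ} {r s : ℕ} (hη : IsOfTypeAt r s η)
    (hrs : r ≠ s) : analyticCyclePeriod Φ hZ η = 0 :=
  (analyticChain Φ hZ).torusPeriod_eq_zero_of_isOfTypeAt Φ hη hrs

/-- **Wirtinger: `∫_Z ω^d/d! = vol_{2d}(Z)`** — the period of the divided power of the flat Kähler form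
is the `𝓗^{2d}`-measure of `reg π⁻¹Z` in the period box. [cite: Chirka1989, §13.3 Corollary and §14.1] -/
theorem analyticCyclePeriod_kaehlerPow {Z : Set (ComplexTorus Φ)} (hZ : HasPureDim 𝓘(ℂ, E) Z d) :
    analyticCyclePeriod Φ hZ (ofRealCLM.compContinuousAlternatingMap (kaehlerPow d)) =
      (((μHE[2 * d] : Measure E).real (periodBox Φ 0 ∩ (analyticChain Φ hZ).carrier) : ℝ) : ℂ) :=
  HolomorphicChain.torusPeriod_ofSet_kaehlerPow Φ (hasPureDim_liftSet Φ hZ)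

variable [DecidableEq ι] {n k : ℕ} (e : Fin n ≃ ι)

/-- **The class `[Z] ∈ H^k(X, ℂ)` of an analytic subset `Z ⊆ X` of pure dimension `d`** (`2d + k = rk Λ`):
the Poincaré dual form (row p07, `ComplexTorusPoincareDualForm.lean`) of its current of integration
on invariant forms, `⟨γ, [Z]⟩_e = ∫_Z γ` — Voisin (2002), §11.1.2: the class of `Z` is the Poincaré
dual of `α ↦ ∫_Z α_{|Z}`. [cite: VoisinHodgeI2002, §11.1.2 Cor. 11.15] -/
def analyticCycleClass (h : 2 * d + k = n) {Z : Set (ComplexTorus Φ)} (hZ : HasPureDim 𝓘(ℂ, E) Z d) :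
    E [⋀^Fin k]→L[ℝ] ℂ :=
  poincareDualForm Φ e h (analyticCyclePeriod Φ hZ)

/-- **`⟨γ, [Z]⟩_e = ∫_Z γ`.** [cite: VoisinHodgeI2002, §11.1.2 Cor. 11.15] -/
@[simp] theorem poincarePairing_analyticCycleClass (h : 2 * d + k = n) {Z : Set (ComplexTorus Φ)}
    (hZ : HasPureDim 𝓘(ℂ, E) Z d) (γ : E [⋀^Fin (2 * d)]→L[ℝ] ℂ) :
    poincarePairing Φ e h γ (analyticCycleClass Φ e h hZ) = analyticCyclePeriod Φ hZ γ :=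
  poincarePairing_poincareDualForm Φ e h _ γ

/-- **The class of an analytic subvariety of codimension `p` is of type `(p, p)`** (Voisin (2002),
Prop. 11.20: "The image in `H^{2r}(X, ℂ)` of the class `[Z]` lies in `H^{r,r}(X)`") — for the constant
forms of a complex torus, unconditionally. [cite: VoisinHodgeI2002, §11.1.3 Prop. 11.20] -/
theorem isOfTypeAt_analyticCycleClass (h : 2 * d + k = n) {p : ℕ} (hk : p + p = k)
    {Z : Set (ComplexTorus Φ)} (hZ : HasPureDim 𝓘(ℂ, E) Z d) :
    IsOfTypeAt p p (analyticCycleClass Φ e h hZ) :=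
  isOfTypeAt_poincareDualForm_torusPeriod Φ e h hk _

/-- **With integral periods, `[Z]` is an integral Hodge class**: if `∫_Z η ∈ ℤ` for every
`η ∈ H^{2d}(X, ℤ) = integralForms Φ (2d)` (the fundamental class of `Z` is integral — Voisin (2002),
§11.1.2), then `[Z] ∈ integralHodgeClasses Φ p = H^{2p}(X, ℤ) ∩ H^{p,p}` (Prop. 11.20 as printed).
[cite: VoisinHodgeI2002, §11.1.3 Prop. 11.20] -/
theorem analyticCycleClass_mem_integralHodgeClasses {p : ℕ} (h : 2 * d + 2 * p = n)
    {Z : Set (ComplexTorus Φ)} (hZ : HasPureDim 𝓘(ℂ, E) Z d)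
    (hint : ∀ η ∈ integralForms Φ (2 * d), ∃ z : ℤ, analyticCyclePeriod Φ hZ η = z) :
    analyticCycleClass Φ e h hZ ∈ integralHodgeClasses Φ p :=
  poincareDualForm_torusPeriod_mem_integralHodgeClasses Φ e h _ hint

/-- … and then a Hodge class (Lange (2023), Lemma 6.2.7). [cite: Lange2023AbelianVarietiesComplex, §6.2.1 Lemma 6.2.7] -/
theorem analyticCycleClass_mem_hodgeClasses {p : ℕ} (h : 2 * d + 2 * p = n)
    {Z : Set (ComplexTorus Φ)} (hZ : HasPureDim 𝓘(ℂ, E) Z d)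
    (hint : ∀ η ∈ integralForms Φ (2 * d), ∃ z : ℤ, analyticCyclePeriod Φ hZ η = z) :
    analyticCycleClass Φ e h hZ ∈ hodgeClasses Φ p :=
  poincareDualForm_torusPeriod_mem_hodgeClasses Φ e h _ hint

/-- **`⟨ω^d/d!, [Z]⟩_e = vol_{2d}(Z)`** (Wirtinger). [cite: Chirka1989, §13.3 Corollary and §14.1] -/
theorem poincarePairing_kaehlerPow_analyticCycleClass (h : 2 * d + k = n) {Z : Set (ComplexTorus Φ)}
    (hZ : HasPureDim 𝓘(ℂ, E) Z d) :
    poincarePairing Φ e h (ofRealCLM.compContinuousAlternatingMap (kaehlerPow d))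
        (analyticCycleClass Φ e h hZ) =
      (((μHE[2 * d] : Measure E).real (periodBox Φ 0 ∩ (analyticChain Φ hZ).carrier) : ℝ) : ℂ) := by
  rw [poincarePairing_analyticCycleClass, analyticCyclePeriod_kaehlerPow]

/-- **An analytic subvariety of positive volume has non-zero class.**
[cite: Chirka1989, §13.3 Corollary and §14.1] -/
theorem analyticCycleClass_ne_zero_of_measure_pos (h : 2 * d + k = n) {Z : Set (ComplexTorus Φ)}
    (hZ : HasPureDim 𝓘(ℂ, E) Z d)
    (hpos : 0 < (μHE[2 * d] : Measure E) (periodBox Φ 0 ∩ (analyticChain Φ hZ).carrier)) :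
    analyticCycleClass Φ e h hZ ≠ 0 :=
  poincareDualForm_torusPeriod_ne_zero_of_measure_pos Φ e h (hasPureDim_liftSet Φ hZ) hpos

end ComplexTorus

end Literature.Geometry.Kaehler

end
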